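import Summits.CriticalPhenomena.PercolationContinuityZ3.Theorems.PercNearOneGluingNoHeavyLowerTailSahiE3DnfWidthTwo
import Mathlib.Logic.Equiv.Prod
import Mathlib.Tactic.Linarith
import HarnessLib
import HarnessLib.Audit

/-!
# `NoHeavyLowerTail` (crux stmt-CriticalPhenomena-4575), Sahi programme P4: SAHI'S `C₃` / KAHN'S CONJECTURE 5 FOR THE FIRST SLOT
# `⋁ᵢ (xᵢ ∧ yᵢ) ∨ F(z)`, `F` any linear read-once formula — DNF of width two over a linear read-once tail

Support file (cell `prim-l12`, seat P4, generation 14; `--supports stmt-CriticalPhenomena-4575`).  No named facts, no sorries;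
standard axioms; def-free.

`cert_dnf_width2_over_lro_cube`: `…SahiE3DimerOver.cert_dimer_over` over the base certificate `…SahiE3LroSlot.cert_lro` of a linear
read-once formula `z₀ ∘₀ (z₁ ∘₁ (⋯ z_m))`, transported to the pattern cube `(Fin n × Bool) ⊕ Fin (m+1) → Bool`; then the lattice form
`latticeE3_nonneg_of_dnf_width2_over_lro` and the Boolean form `latticeE3_nonneg_dnf_width2_over_lro_prod` (`θ ≥ 0`, distinct generators,
arbitrary up-sets `A, B`), e.g. the first slots `⋁ᵢ(xᵢ∧yᵢ) ∨ z₀ ∨ ⋯ ∨ z_m`, `⋁ᵢ(xᵢ∧yᵢ) ∨ (z₀ ∧ ⋯ ∧ z_m)`, `⋁ᵢ(xᵢ∧yᵢ) ∨ z₀ ∨ (z₁ ∧ z₂)`.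
HOME prim-l12-p4/FROM-prim-l12-p4-gen14-DIMER-REDUCTION.md.
-/

namespace Summit.CriticalPhenomena.PercolationContinuityZ3.Theorems.SahiE3DnfWidthTwoOverLro

open Finset SahiE3DimerOver SahiE3LroTransport
open scoped BigOperators

/-- **The certificate of `⋁ᵢ (xᵢ ∧ yᵢ) ∨ F(z)` on the pattern cube** `(Fin n × Bool) ⊕ Fin (m+1) → Bool` (`F` the linear read-once
formula with operations `ops`), product weight `∏ w ≥ 0`. [this work] -/
theorem cert_dnf_width2_over_lro_cube (n m : ℕ) (ops : Fin m → Bool) (w : (Fin n × Bool) ⊕ Fin (m + 1) → Bool → ℝ)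
    (hw : ∀ p c, 0 ≤ w p c) (ν : ((Fin n × Bool) ⊕ Fin (m + 1) → Bool) → ℝ) (hν : ∀ t, ν t = ∏ p, w p (t p))
    (U : Finset ((Fin n × Bool) ⊕ Fin (m + 1) → Bool))
    (hU : ∀ t, t ∈ U ↔ ((∃ i, t (Sum.inl (i, true)) = true ∧ t (Sum.inl (i, false)) = true) ∨
      Fin.foldr m (fun i b => bif ops i then (t (Sum.inr i.castSucc) || b) else (t (Sum.inr i.castSucc) && b))
        (t (Sum.inr (Fin.last m))) = true)) :
    IsUpperSet (U : Set ((Fin n × Bool) ⊕ Fin (m + 1) → Bool)) ∧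
    ∃ (R : ((Fin n × Bool) ⊕ Fin (m + 1) → Bool) → ℝ)
      (Fl : ((Fin n × Bool) ⊕ Fin (m + 1) → Bool) → ((Fin n × Bool) ⊕ Fin (m + 1) → Bool) → ℝ),
      (∀ t ∈ U, 0 ≤ R t) ∧ (∀ t s, 0 ≤ Fl t s) ∧ (∀ t s, Fl t s ≠ 0 → s ≤ t) ∧
      (∀ t ∈ U, R t + ∑ s ∈ Uᶜ, Fl t s ≤ (∑ r, ν r) * ((∑ r, ν r) + ∑ r ∈ Uᶜ, ν r) * ν t) ∧
      (∀ s ∈ Uᶜ, ∑ t ∈ U, Fl t s = (∑ r, ν r) * (∑ r ∈ U, ν r) * ν s) ∧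
      (∀ S S' : Finset ((Fin n × Bool) ⊕ Fin (m + 1) → Bool), IsUpperSet (S : Set ((Fin n × Bool) ⊕ Fin (m + 1) → Bool)) →
        IsUpperSet (S' : Set ((Fin n × Bool) ⊕ Fin (m + 1) → Bool)) →
        (∑ r, ν r) * ((∑ t ∈ S, ν t) * (∑ t ∈ S' ∩ U, ν t) + (∑ t ∈ S', ν t) * (∑ t ∈ S ∩ U, ν t))
            - (∑ r ∈ U, ν r) * (∑ t ∈ S, ν t) * (∑ t ∈ S', ν t) ≤ ∑ t ∈ (S ∩ S') ∩ U, R t) := by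
  -- the base: the linear read-once formula on `Fin (m+1) → Bool`
  obtain ⟨νQ, hνQ⟩ : ∃ f : (Fin (m + 1) → Bool) → ℝ, ∀ q, f q = ∏ k, w (Sum.inr k) (q k) := ⟨_, fun _ => rfl⟩
  obtain ⟨G, hG⟩ : ∃ V : Finset (Fin (m + 1) → Bool), ∀ q, q ∈ V ↔ Fin.foldr m (fun i b => bif ops i then
      (q i.castSucc || b) else (q i.castSucc && b)) (q (Fin.last m)) = true :=
    ⟨univ.filter fun q => Fin.foldr m (fun i b => bif ops i then (q i.castSucc || b) else (q i.castSucc && b))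
      (q (Fin.last m)) = true, fun q => by simp⟩
  obtain ⟨hGup, hHQ, RQ, FlQ, g1, g2, g3, g4, g5, g6⟩ :=
    SahiE3LroSlot.cert_lro m ops (fun k => w (Sum.inr k)) (fun k c => hw _ _) νQ hνQ G hG
  have hνQ0 : ∀ q, 0 ≤ νQ q := fun q => by rw [hνQ]; exact Finset.prod_nonneg fun k _ => hw _ _
  obtain ⟨hUp, -, R, Fl, c1, c2, c3, c4, c5, c6⟩ := cert_dimer_over hνQ0 hHQ G hGup RQ FlQ g1 g2 g3 g4 g5 g6
    n (fun i => w (Sum.inl (i, true))) (fun i => w (Sum.inl (i, false))) (fun i b => hw _ _) (fun i b => hw _ _)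
    (fun x => (∏ i, w (Sum.inl (i, true)) (x.1 i).1 * w (Sum.inl (i, false)) (x.1 i).2) * νQ x.2) (fun _ => rfl)
    (univ.filter fun x : (Fin n → Bool × Bool) × (Fin (m + 1) → Bool) => (∃ i, x.1 i = (true, true)) ∨ x.2 ∈ G)
    (fun x => by simp)
  -- transport to the cube
  let e : ((Fin n → Bool × Bool) × (Fin (m + 1) → Bool)) ≃o ((Fin n × Bool) ⊕ Fin (m + 1) → Bool) :=
    { toFun := fun x => Sum.elim (fun p : Fin n × Bool => if p.2 = true then (x.1 p.1).1 else (x.1 p.1).2) x.2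
      invFun := fun t => (fun i => (t (Sum.inl (i, true)), t (Sum.inl (i, false))), fun k => t (Sum.inr k))
      left_inv := fun x => by
        rcases x with ⟨f, q⟩
        simp only [Sum.elim_inl, ↓reduceIte, Bool.false_eq_true, Prod.mk.eta, Sum.elim_inr]
      right_inv := fun t => by
        funext p; rcases p with ⟨i, b⟩ | k
        · cases b <;> simp
        · simp
      map_rel_iff' := by
        rintro ⟨f, q⟩ ⟨g, q'⟩
        simp only [Equiv.coe_fn_mk, Prod.mk_le_mk, Pi.le_def, Sum.forall, Sum.elim_inl, Sum.elim_inr, Prod.forall,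
          Bool.forall_bool, ↓reduceIte, Bool.false_eq_true]
        constructor
        · rintro ⟨h1, h2⟩
          exact ⟨fun i => Prod.mk_le_mk.2 ⟨(h1 i).2, (h1 i).1⟩, h2⟩
        · rintro ⟨h1, h2⟩
          exact ⟨fun i => ⟨(Prod.mk_le_mk.1 (h1 i)).2, (Prod.mk_le_mk.1 (h1 i)).1⟩, h2⟩ }
  have hes : ∀ t : (Fin n × Bool) ⊕ Fin (m + 1) → Bool,
      e.symm t = (fun i => (t (Sum.inl (i, true)), t (Sum.inl (i, false))), fun k => t (Sum.inr k)) := fun t => rfl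
  have hνe : ∀ t, ν t = (fun x : (Fin n → Bool × Bool) × (Fin (m + 1) → Bool) =>
      (∏ i, w (Sum.inl (i, true)) (x.1 i).1 * w (Sum.inl (i, false)) (x.1 i).2) * νQ x.2) (e.symm t) := by
    intro t
    rw [hes, hν, Fintype.prod_sum_type, Fintype.prod_prod_type]
    simp only [Fintype.prod_bool, hνQ]
  have hUe : ∀ t, t ∈ U ↔ e.symm t ∈ (univ.filter fun x : (Fin n → Bool × Bool) × (Fin (m + 1) → Bool) =>
      (∃ i, x.1 i = (true, true)) ∨ x.2 ∈ G) := by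
    intro t
    rw [hes, hU, Finset.mem_filter]
    simp only [Finset.mem_univ, true_and, Prod.mk.injEq, hG]
  obtain ⟨R', Fl', d1, d2, d3, d4, d5, d6⟩ := cert_transport e c1 c2 c3 c4 c5 c6 ν hνe U hUe
  refine ⟨?_, R', Fl', d1, d2, d3, d4, d5, d6⟩
  intro x y hxy hx
  simp only [Finset.mem_coe] at hx ⊢
  rw [hUe] at hx ⊢
  exact hUp (e.symm.monotone hxy) hx

/-! ### The lattice theorem and the Boolean form -/

section Lattice

open Literature.Probability.LatticeModels

variable {α : Type*} [DistribLattice α] [Fintype α] [DecidableEq α] [DecidableLE α]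

open scoped Classical in
/-- **Sahi's `C₃` for `⋁ᵢ (xᵢ ∧ yᵢ) ∨ F(z)` over join-primes, lattice form** (`F` linear read-once with operations `ops`;
product pattern marginal `∏ w`, `w ≥ 0`). [this work] -/
theorem latticeE3_nonneg_of_dnf_width2_over_lro {μ : α → ℝ} (hμ₀ : 0 ≤ μ)
    (hμ : ∀ x y, μ x * μ y ≤ μ (x ⊓ y) * μ (x ⊔ y)) (n m : ℕ) (ops : Fin m → Bool)
    {j : (Fin n × Bool) ⊕ Fin (m + 1) → α} (hj : ∀ i, SupPrime (j i))
    {F : ((Fin n × Bool) ⊕ Fin (m + 1) → Bool) → Finset α}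
    (hF : ∀ (t : (Fin n × Bool) ⊕ Fin (m + 1) → Bool) (x : α), x ∈ F t ↔ ∀ i, (j i ≤ x ↔ t i = true))
    {A B : Finset α} (hA : IsUpperSet (A : Set α)) (hB : IsUpperSet (B : Set α))
    (w : (Fin n × Bool) ⊕ Fin (m + 1) → Bool → ℝ) (hw : ∀ p c, 0 ≤ w p c) (hν : ∀ t, mass μ (F t) = ∏ p, w p (t p))
    (U' : Finset ((Fin n × Bool) ⊕ Fin (m + 1) → Bool))
    (hU' : ∀ t, t ∈ U' ↔ ((∃ i, t (Sum.inl (i, true)) = true ∧ t (Sum.inl (i, false)) = true) ∨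
      Fin.foldr m (fun i b => bif ops i then (t (Sum.inr i.castSucc) || b) else (t (Sum.inr i.castSucc) && b))
        (t (Sum.inr (Fin.last m))) = true)) :
    0 ≤ latticeE3 μ (univ.filter fun x => (fun i => decide (j i ≤ x)) ∈ U') A B := by
  obtain ⟨-, R, Fl, h1, h2, h3, h4, h5, h6⟩ :=
    cert_dnf_width2_over_lro_cube n m ops w hw (fun t => ∏ p, w p (t p)) (fun _ => rfl) U' hU'
  refine SahiE3PatternCertificate.latticeE3_nonneg_of_patternCertificate hμ₀ hμ hj hF hA hB U'
    (fun t => ∏ p, w p (t p)) (fun t => (hν t).symm) R Fl h1 h2 h3 h4 (fun s hs => (h5 s hs).ge) ?_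
  intro S S' hS hS'
  have hz : ∑ s ∈ (S ∩ S') ∩ U'ᶜ, (∑ t ∈ U', Fl t s - (∑ r : (Fin n × Bool) ⊕ Fin (m + 1) → Bool, ∏ p, w p (r p)) *
      (∑ r ∈ U', ∏ p, w p (r p)) * ∏ p, w p (s p)) = 0 :=
    Finset.sum_eq_zero fun s hs => by rw [h5 s (Finset.mem_inter.1 hs).2, sub_self]
  rw [hz, add_zero]
  exact h6 S S' hS hS'

end Lattice

section Cube

open Literature.Probability.LatticeModels

variable {κ : Type*} [Fintype κ] [DecidableEq κ]

/-- **Kahn's Conjecture 5 for the first slot `⋁ᵢ (xᵢ ∧ yᵢ) ∨ F(z)`, product weights on `2^κ`** (`θ ≥ 0`, distinct generators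
`v : (Fin n × Bool) ⊕ Fin (m+1) → κ`, `F` the linear read-once formula with operations `ops`, `A, B` arbitrary up-sets). [this work] -/
theorem latticeE3_nonneg_dnf_width2_over_lro_prod {θ : κ → ℝ} (hθ : ∀ u, 0 ≤ θ u) (n m : ℕ) (ops : Fin m → Bool)
    {v : (Fin n × Bool) ⊕ Fin (m + 1) → κ} (hv : Function.Injective v) {A B : Finset (Finset κ)}
    (hA : IsUpperSet (A : Set (Finset κ))) (hB : IsUpperSet (B : Set (Finset κ))) :
    0 ≤ latticeE3 (fun ω : Finset κ => ∏ u ∈ ω, θ u)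
      (univ.filter fun ω : Finset κ => (∃ i, v (Sum.inl (i, true)) ∈ ω ∧ v (Sum.inl (i, false)) ∈ ω) ∨
        Fin.foldr m (fun i b => bif ops i then (decide (v (Sum.inr i.castSucc) ∈ ω) || b)
          else (decide (v (Sum.inr i.castSucc) ∈ ω) && b)) (decide (v (Sum.inr (Fin.last m)) ∈ ω)) = true) A B := by
  classical
  set F : ((Fin n × Bool) ⊕ Fin (m + 1) → Bool) → Finset (Finset κ) :=
    fun t => univ.filter fun ω : Finset κ => ∀ l, (v l ∈ ω ↔ t l = true) with hFdef
  have hF : ∀ (t : (Fin n × Bool) ⊕ Fin (m + 1) → Bool) (ω : Finset κ), ω ∈ F t ↔ ∀ l, (v l ∈ ω ↔ t l = true) := by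
    intro t ω; simp [hFdef]
  have hF' : ∀ (t : (Fin n × Bool) ⊕ Fin (m + 1) → Bool) (ω : Finset κ), ω ∈ F t ↔ ∀ l, (({v l} : Finset κ) ≤ ω ↔ t l = true) := by
    intro t ω; rw [hF]; simp
  set C : ℝ := ∑ ω ∈ ((univ : Finset ((Fin n × Bool) ⊕ Fin (m + 1))).image v)ᶜ.powerset, ∏ u ∈ ω, θ u with hC
  have hC0 : 0 ≤ C := Finset.sum_nonneg fun ω _ => Finset.prod_nonneg fun u _ => hθ u
  set w : (Fin n × Bool) ⊕ Fin (m + 1) → Bool → ℝ :=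
    fun p c => (if c = true then θ (v p) else 1) * (if p = Sum.inr (Fin.last m) then C else 1) with hw
  have hw0 : ∀ p c, 0 ≤ w p c := by
    intro p c; simp only [hw]
    refine mul_nonneg ?_ ?_ <;> split_ifs
    · exact hθ _
    · exact zero_le_one
    · exact hC0
    · exact zero_le_one
  have hν : ∀ t, mass (fun ω : Finset κ => ∏ u ∈ ω, θ u) (F t) = ∏ p, w p (t p) := by
    intro t
    rw [SahiE3LroCube.mass_fib_prod θ hv hF t, ← hC, hw, Finset.prod_mul_distrib,
      Finset.prod_ite_eq' univ (Sum.inr (Fin.last m) : (Fin n × Bool) ⊕ Fin (m + 1))]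
    simp
  obtain ⟨U', hU'⟩ : ∃ V : Finset ((Fin n × Bool) ⊕ Fin (m + 1) → Bool), ∀ t, t ∈ V ↔
      ((∃ i, t (Sum.inl (i, true)) = true ∧ t (Sum.inl (i, false)) = true) ∨
      Fin.foldr m (fun i b => bif ops i then (t (Sum.inr i.castSucc) || b) else (t (Sum.inr i.castSucc) && b))
        (t (Sum.inr (Fin.last m))) = true) :=
    ⟨univ.filter fun t => (∃ i, t (Sum.inl (i, true)) = true ∧ t (Sum.inl (i, false)) = true) ∨
      Fin.foldr m (fun i b => bif ops i then (t (Sum.inr i.castSucc) || b) else (t (Sum.inr i.castSucc) && b))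
        (t (Sum.inr (Fin.last m))) = true, fun t => by simp⟩
  have key := latticeE3_nonneg_of_dnf_width2_over_lro (SahiE3HitSlotProduct.prod_nonneg' hθ) (SahiE3HitSlotProduct.prod_lsm θ) n m ops
    (fun i => SahiE3CovHit.supPrime_singleton' (v i)) hF' hA hB w hw0 hν U' hU'
  have hslot : (univ.filter fun ω : Finset κ => (fun i => decide (({v i} : Finset κ) ≤ ω)) ∈ U') =
      univ.filter fun ω : Finset κ => (∃ i, v (Sum.inl (i, true)) ∈ ω ∧ v (Sum.inl (i, false)) ∈ ω) ∨
        Fin.foldr m (fun i b => bif ops i then (decide (v (Sum.inr i.castSucc) ∈ ω) || b)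
          else (decide (v (Sum.inr i.castSucc) ∈ ω) && b)) (decide (v (Sum.inr (Fin.last m)) ∈ ω)) = true := by
    congr 1; ext ω; simp [hU']
  rw [hslot] at key
  exact key

end Cube

end Summit.CriticalPhenomena.PercolationContinuityZ3.Theorems.SahiE3DnfWidthTwoOverLro
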